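import Literature.IUT.HodgeArakelov.GaloisPairRigiditySubdagQuot

/-!
# [IUTchII] §1, Corollary 1.11: NON-VACUITY of the typed data — the tautological Galois-pair rigidity data
# over ANY [AbsTopIII] output interface, and the Cor. 1.11 functor it yields

Mochizuki, *Inter-universal Teichmüller theory II*, §1, Corollary 1.11, kurims manuscript (Dec. 2020)
p. 49 [claim: Mochizuki2012, status: disputed] (IUTchII §1 Cor 1.11, kurims p.49). Record-only typing under
the claim key `Mochizuki2012` (D-0012, disputed); abc-iut cell, layer L6, sub-DAG of `IUTchII:Cor1.11`
(holder abc-iut-w5-d089). NON-VACUITY CERTIFICATE (cell referee protocol: a typed interface all of whose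
consumers are conditional must be shown INHABITED, lest the conditional theorems be vacuous): abc-iut-L6-t1's
interface `GaloisPairRigidityData A` (p409065) and this sub-DAG's `Π`-transport input `LDTransport`
(p414121) are inhabited over EVERY `A : AbsTopMonoids S` by the TAUTOLOGICAL data

* `μ_Ẑ(G) := μ_Ẑ(O^×(G)) = Λ(O^×(G))` itself, transported along `G ≅ G*` by `Λ(O^×(−))`
  (`cyclotome.mapEquiv ∘ Units.mapEquiv ∘ mapOtri`), trivial `Ẑ^×`-twist, rigidity isomorphism
  `(*bs-Gal_{G,⊳}) := id`;
* `(l·Δ_Θ)(Π) := μ_Ẑ(O^×(Π/Δ))`, `corPiX := id`, transported along `Π ≅ Π*` through the CONSTRUCTED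
  quotient map `AbsTopMonoids.quotMap` (p413731);

so that every law of both structures holds by functoriality of `Λ` and of `Π ↦ Π/Δ`
(`GaloisPairRigidityData.tautological`, `GaloisPairRigidityData.tautologicalLD`), and the functor `ℛ → ℱ` of
Corollary 1.11 (`cor111FunctorOfMapLD`, p414121/p413682) EXISTS over every `A` (`cor111FunctorTautological`,
with its multiradiality instance). HONEST LABEL: this is the DEGENERATE witness (identity rigidity, trivial
twist) — it certifies joint satisfiability of the typed laws, nothing about the genuine [AbsTopIII]
Rmk. 3.2.1 / Cor. 1.10 (c) isomorphisms, whose instance is the cell's MERGE-MAP row B12. No named fact;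
nothing here bears on [IUTchIII] Cor. 3.12.
-/

noncomputable section

namespace Literature.IUT.HodgeArakelov

open CategoryTheory
open Literature.AnabelianGeometry.EtaleTheta

universe u

variable {S : ThetaSetting.{u}} (A : AbsTopMonoids S)

namespace GaloisPairRigidityData

/-- **Non-vacuity of `GaloisPairRigidityData`** (IUTchII:Cor1.11, kurims p. 49): the TAUTOLOGICAL
Galois-pair rigidity data over any `A : AbsTopMonoids S` — `μ_Ẑ(G) := Λ(O^×(G))` with the functorial
transport `Λ(O^×(G ≅ G*))`, trivial `Ẑ^×`-twist, `(*bs-Gal_{G,⊳}) := id`, `(l·Δ_Θ)(Π) := Λ(O^×(Π/Δ))`,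
`corPiX := id`. DEFINED; all laws PROVED (functoriality of `Λ`, `mapOtri_id/_comp`).
[claim: Mochizuki2012, status: disputed] (IUTchII §1 Cor 1.11, kurims p.49) -/
def tautological : GaloisPairRigidityData A where
  muZhat G := A.muZhatUnits G
  mapMu f := cyclotome.mapEquiv (Units.mapEquiv (A.mapOtri f))
  mapMu_id G := by
    show cyclotome.mapEquiv (Units.mapEquiv (A.mapOtri (𝟙 G))) = MulEquiv.refl _
    rw [A.mapOtri_id]
    exact MulEquiv.ext fun x => Subtype.ext (funext fun n => Units.ext rfl)
  mapMu_comp f g := by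
    show cyclotome.mapEquiv (Units.mapEquiv (A.mapOtri (f ≫ g))) = _
    rw [A.mapOtri_comp]
    exact MulEquiv.ext fun x => Subtype.ext (funext fun n => Units.ext rfl)
  twist G := 1
  twist_natural f u x := by
    simp only [MonoidHom.one_apply, MulAut.one_apply]
  bsGalTri G := MulEquiv.refl _
  bsGalTri_natural f x := Subtype.ext (funext fun n => Units.ext rfl)
  lDeltaTheta P := A.muZhatUnits (A.quotObj P)
  corPiX P := MulEquiv.refl _

/-- On elements, the tautological transport is `Λ(O^×(f))`. [claim: Mochizuki2012, status: disputed]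
(IUTchII §1 Cor 1.11, kurims p.49) -/
theorem tautological_mapMu {G H : IsoClass S.Gk} (f : G ⟶ H) (x : A.muZhatUnits G) :
    (tautological A).mapMu f x = cyclotome.mapEquiv (Units.mapEquiv (A.mapOtri f)) x := rfl

/-- **Non-vacuity of the `Π`-transport input** (sub-DAG row S4, reduced form `LDTransport` of p414121):
for the tautological data, `(l·Δ_Θ)(Π) = Λ(O^×(Π/Δ))` is transported along `Π ≅ Π*` by `Λ(O^×(−))` of the
INDUCED isomorphism of quotients `AbsTopMonoids.quotMap` (p413731), and `corPiX = id` is natural.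
DEFINED; laws PROVED from `quotMap_id/_comp`. [claim: Mochizuki2012, status: disputed]
(IUTchII §1 Cor 1.11, kurims p.49) -/
def tautologicalLD : (tautological A).LDTransport where
  mapLD h := (tautological A).mapMu (A.quotMap h)
  mapLD_id P := by
    show (tautological A).mapMu (A.quotMap (𝟙 P)) = _
    rw [A.quotMap_id]
    exact (tautological A).mapMu_id _
  mapLD_comp f g := by
    show (tautological A).mapMu (A.quotMap (f ≫ g)) = _
    rw [A.quotMap_comp]
    exact (tautological A).mapMu_comp _ _
  corPiX_natural h x := rfl

end GaloisPairRigidityData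

/-- **IUTchII:Cor1.11 — the functor `ℛ → ℱ` EXISTS over every [AbsTopIII] output interface** (non-vacuity of
the hypotheses of `GaloisPairRigidityData.cor111Functor` / `cor111FunctorOfMapLD`): the Cor. 1.11 functor
of the tautological data, for any orbit group `Γ ⊆ Ẑ^×` and twisting group `Γ'`.
[claim: Mochizuki2012, status: disputed] (IUTchII §1 Cor 1.11, kurims p.49) -/
abbrev cor111FunctorTautological (Γ : Subgroup ZHatUnits) (Γ' : Type u) [Group Γ'] :
    IsoClass S.PiX × TwistedIsoClass S.Gk Γ' ⥤ Cor111Tuple.{u} :=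
  (GaloisPairRigidityData.tautological A).cor111FunctorOfMapLD Γ
    (GaloisPairRigidityData.tautologicalLD A) Γ'

/-- … and its "`Ψ_ℛ : ℛ → ℛ†` is multiradially defined" (IUTchII:Cor1.11, p. 49 ll. 44–46) — so the
typed Corollary 1.11 has an UNCONDITIONAL instance over every `A` (degenerate rigidity; see the file
docstring). [claim: Mochizuki2012, status: disputed] (IUTchII §1 Cor 1.11, kurims p.49) -/
theorem cor111FunctorTautological_multiradiallyDefined (Γ : Subgroup ZHatUnits) (Γ' : Type u)
    [Group Γ'] :
    ((ex18iii S Γ').toDagger (cor111FunctorTautological A Γ Γ')).IsMultiradiallyDefined :=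
  cor111FunctorOfMapLD_multiradiallyDefined _ Γ _ Γ'

/-- The orbit (a) of the tautological data at any `G` contains the identity (it is `{id}` twisted by `Γ`
acting trivially): the orbit sets carried by the functor are NONEMPTY — the poly-isomorphisms of the tuple are
not the empty poly-isomorphism. [claim: Mochizuki2012, status: disputed] (IUTchII §1 Cor 1.11, kurims p.49) -/
theorem tautological_orbitA_nonempty (Γ : Subgroup ZHatUnits) (G : IsoClass S.Gk) :
    ((GaloisPairRigidityData.tautological A).orbitA Γ G).Nonempty :=
by
  refine ⟨MulEquiv.refl _, 1, Γ.one_mem, MulEquiv.ext fun x => ?_⟩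
  change x = (MulEquiv.refl _) (((1 : ZHatUnits →* MulAut (A.muZhatUnits G)) 1) x)
  rw [MonoidHom.one_apply, MulAut.one_apply]
  rfl

/-- The orbit (b) of the tautological data at `(Π, G)` is NONEMPTY (it contains `Λ(O^×(e))` for any
isomorphism `e : G ≅ Π/Δ`, which exists since `IsoClass G_k` is connected).
[claim: Mochizuki2012, status: disputed] (IUTchII §1 Cor 1.11, kurims p.49) -/
theorem tautological_orbitB_nonempty (P : IsoClass S.PiX) (G : IsoClass S.Gk) :
    ((GaloisPairRigidityData.tautological A).orbitB P G).Nonempty := by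
  obtain ⟨e⟩ := IsoClass.nonempty_hom G (A.quotObj P)
  exact ⟨_, e, rfl⟩

end Literature.IUT.HodgeArakelov

end
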